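import Summits.Ventures.Crystal3D.Theorems.StickyWulffConstantCoaxialWallLawTailResidueDefsU
import Summits.Ventures.Crystal3D.Theorems.StickyWulffConstantCoaxialWallLawEndRowJointDefs
import HarnessLib

/-!
# Definitions: THE ONE-JAMMED-BALL CENSUS `JammedOneCensus s` — a finite rational certificate target for the U-A1 stub `JammedOneSmall`
# (crux `CoaxialWallLaw`, stmt-Ventures-19481; v5 texts `…TailResidueDefsU`; memo HOME/wall-19481-p2/F-TAIL-g10.md §10–§11, universe U-A1)

HONEST FRAMING. Venture `Summits/Ventures/Crystal3D` (cell `crystal3d-full`); DEFINITIONS for the crux `CoaxialWallLaw` (stmt-Ventures-19481,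
`route-Ventures-StickyWulffConstant`), registered line 'CoaxialWallLawCertificates' v4 (planner cf-p1; v5 texts `JammedOneSmall` / `SeamResidual` in
`…TailResidueDefsU`, composition `…TailResidueClosingU`).  Nothing substantive is claimed; F-C1 not moved.
WHY.  By `…JammedComparison` (`localSummandA_le_of_jammed_module`) the joint (A)-summand at a payer of a U-A1 window «coaxial-module pattern `P` + one
off-module, non-capping ball `x` of `≤ 3` contacts» is bounded by a RE-EVALUATION of the on-site window `P` with pools lowered by the number of
contacts of `x` nearby and raised by `9` at the contacts themselves; by the on-site domination (`dominate_joint_menu`) its end multiplicities are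
those of ONE of the `16 + 1` signature rows `transSigs ε n` / `jointSigs`.  Hence the U-A1 stub follows from a FINITE statement over
(pattern `P ∈ 𝒰_cx`, contact set `T ⊆ P`), which this file names (owner of the certificate: cf-p2 / eng; the reduction `jammedOneSmall_of_census` is the
next file of this lane):
* `contactCount T b` — `#{t ∈ T : dist b t ≤ 1}`; **`lowPool P T b`** `= pooledDef P b − contactCount T b + 9·[b ∈ T]` (the jammed ball un-heals one
  unit at each of its contacts within `1` of `b`, and contributes its own deficiency `≥ 9` to the pools of its contacts);
* **`localStatSigLow P T v Σ z`** — the signature statistic `localStatSig` with `lowPool` denominators;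
* **`JammedRealisable P T`** — `T` IS the contact set of some point `x` off the module, within `3` of the payer, `1`-separated from `P`, with
  `#T ≤ 3` and `T` not a unit triangle (non-capping);
* **`JammedOneCensus s`** — for every `P ∈ 𝒰_cx` and every realisable `T`: all lowered pools within `1` of the payer are positive, and the `16`
  translation rows and the joint row of `localStatSigLow` at the payer are `≤ s`.  Instance of record `s = 2√6`.
WHAT THIS IS NOT: not the certificate (a finite computation), not the reduction; F-C1 not moved.
-/

noncomputable section

namespace Summit.Ventures.Crystal3D.Theorems

namespace TailResidue

open Summit.Ventures.Crystal3D Finset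
open scoped InnerProductSpace

open scoped Classical in
/-- The number of balls of `T` within distance `1` of `b`. -/
def contactCount (T : Finset (EuclideanSpace ℝ (Fin 3))) (b : EuclideanSpace ℝ (Fin 3)) : ℕ :=
  (T.filter fun t => dist b t ≤ 1).card

open scoped Classical in
/-- **THE LOWERED POOL** of `b` in the pattern `P` relative to the contact set `T` of the jammed ball:
`pooledDef P b − #{t ∈ T : dist b t ≤ 1} + 9·[b ∈ T]`. -/
def lowPool (P T : Finset (EuclideanSpace ℝ (Fin 3))) (b : EuclideanSpace ℝ (Fin 3)) : ℝ :=
  pooledDef P b - (contactCount T b : ℝ) + if b ∈ T then 9 else 0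

open scoped Classical in
/-- **THE LOWERED SIGNATURE STATISTIC** through the signatures `Σ` at the payer `z`: `localStatSig` with `lowPool` denominators. -/
def localStatSigLow (P T : Finset (EuclideanSpace ℝ (Fin 3))) (v : WordVersion) (sig : Finset (Bool × EuclideanSpace ℝ (Fin 3)))
    (z : EuclideanSpace ℝ (Fin 3)) : ℝ :=
  ∑ b ∈ P.filter (fun b => dist z b ≤ 1 ∧ 0 < endMultSig P v sig b), (endMultSig P v sig b : ℝ) / lowPool P T b

open scoped Classical in
/-- **REALISABLE CONTACT SET**: `T` is the set of balls of `P` touching some point `x` OFF the coaxial module, within `3` of the payer `0`,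
at distance `≥ 1` from every ball of `P`, touching at most three of them, and NOT capping (no three pairwise touching balls of `T`). -/
def JammedRealisable (P T : Finset (EuclideanSpace ℝ (Fin 3))) : Prop :=
  ∃ x : EuclideanSpace ℝ (Fin 3), x ∉ coaxialModule 1 (Real.sqrt (2 / 3)) ∧ dist (0 : EuclideanSpace ℝ (Fin 3)) x ≤ 3 ∧
    (∀ p ∈ P, 1 ≤ dist x p) ∧ T = P.filter (fun p => dist x p = 1) ∧ T.card ≤ 3 ∧
    ∀ t₁ ∈ T, ∀ t₂ ∈ T, ∀ t₃ ∈ T, dist t₁ t₂ = 1 → dist t₁ t₃ = 1 → dist t₂ t₃ = 1 → False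

open scoped Classical in
/-- **THE ONE-JAMMED-BALL CENSUS at the line `s`** (finite: patterns of 𝒰_cx × contact sets): for every coaxial-module payer window `P` and every
realisable contact set `T`, every lowered pool within `1` of the payer is positive, and the sixteen translation rows and the joint row of the
lowered signature statistic at the payer are `≤ s`.  Register `s = 2√6`. -/
def JammedOneCensus (s : ℝ) : Prop :=
  ∀ P ∈ coaxialModuleUniverse, ∀ T : Finset (EuclideanSpace ℝ (Fin 3)), JammedRealisable P T →
    (∀ b ∈ P, dist (0 : EuclideanSpace ℝ (Fin 3)) b ≤ 1 → 0 < lowPool P T b) ∧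
    (∀ ε : Bool, ∀ n ∈ modelNormals, localStatSigLow P T WordVersion.v2 (transSigs ε n) 0 ≤ s) ∧
    localStatSigLow P T WordVersion.v2 jointSigs 0 ≤ s

/-- The census is monotone in the line. -/
theorem jammedOneCensus_mono {s t : ℝ} (hst : s ≤ t) (h : JammedOneCensus s) : JammedOneCensus t := by
  intro P hP T hT
  obtain ⟨hpos, htr, hj⟩ := h P hP T hT
  exact ⟨hpos, fun ε n hn => (htr ε n hn).trans hst, hj.trans hst⟩

/-- With positive lowered pools every term of the lowered statistic is nonnegative. -/
theorem localStatSigLow_nonneg {P T : Finset (EuclideanSpace ℝ (Fin 3))} {v : WordVersion} {sig : Finset (Bool × EuclideanSpace ℝ (Fin 3))}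
    (hpos : ∀ b ∈ P, dist (0 : EuclideanSpace ℝ (Fin 3)) b ≤ 1 → 0 < lowPool P T b) : 0 ≤ localStatSigLow P T v sig 0 := by
  classical
  unfold localStatSigLow
  exact sum_nonneg fun b hb => div_nonneg (Nat.cast_nonneg _) (hpos b (mem_filter.1 hb).1 (mem_filter.1 hb).2.1).le

end TailResidue

end Summit.Ventures.Crystal3D.Theorems

end
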